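import Summits.QuantumFields.BalabanUV.T4Continuum.Support.NE7TraceLinkHessianLower
import Summits.QuantumFields.BalabanUV.T4Continuum.Support.NE7LatticeLandauMinimiser
import Mathlib.Analysis.Calculus.Deriv.MeanValue
import HarnessLib

/-!
# NE7 — FIRST-VARIATION BOOKKEEPING FOR THE FREE-BOUNDARY TRACE LINK FUNCTIONAL ON A BOX: the Euler–Lagrange expressions sum to zero over the
# box; the first variation along `e^{tη}` is the pairing `−½Σ_x Re tr(E(x)η_x)∕n` of the direction with the Euler–Lagrange expression; a
# single-site variation has derivative `−Re tr(Z·D(y))∕n`; criticality in every skew direction forces `E(y) = 0`; and a second-order Taylor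
# lower bound on `[0,1]` (F312a)

Cell `pub-balaban`, rung (B)+1 sub-cell t4, lineage `b2b-balaban-t4-ne7-p1` (CRUX PROVER NE7 #1 = OWNER of row NE7), generation 93; memo
`t4/b2b-balaban-t4-ne7-p1-g93/UHLENBECK-ROAD.md` §4.  Over F311b `NE7TraceLinkHessianLower` (shift reindexing on the box), F310 (derivatives along
`e^{ta}Le^{−tc}`), `NE7LatticeLandauMinimiser.nReTr_skew_eq_zero` and Mathlib's mean value inequality.

WHAT ([folklore]; 0 def, 0 sorry):
* §1 `sum_EL_eq_zero` — `Σ_{x ∈ box} E_X(x) = 0` for every bond field (each box bond enters once with each sign): the Euler–Lagrange condition at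
  the pinned site follows from the others.
* §2 `firstVar_resum` (`Σ_b Re tr(η_xV_b − V_bη_{x'}) = Σ_x Re tr(η_x D_V(x))`, `D_V(x) = Σ_κ[𝟙⁺V(x,κ) − 𝟙⁻V(x−e_κ,κ)]`), `nReTr_skew_mul_eq_half`
  (`Re tr(KD) = ½Re tr(K(D − Dᴴ))` for skew `K`), **`abs_firstVar_le`** (`|Σ_b Re tr(η_xV_b − V_bη_{x'})∕n| ≤ ½Σ_x‖η_x‖‖E_V(x)‖`).
* §3 **`hasDerivAt_siteVariation`** (derivative at `0` of the functional along `e^{tZ}` at one site `y`: `−Re tr(Z·D(y))∕n`) and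
  **`EL_of_critical`** (criticality for every skew `Z` ⟹ `D(y) − D(y)ᴴ = 0`).
* §4 **`taylor_lower_unit_interval`** (`g′(0) + c∕2 ≤ g(1) − g(0)` when `g″ ≥ c` on `[0,1]`).
HONEST FRAMING (page 1): elementary; nothing of Bałaban's asserted; NE7 NOT PROVED here; spine 0∕9; finite T⁴ rung (B)+1 — NOT infinite volume, NOT mass
gap, NOT `BetaPertH`, NOT Clay.  No `sorry`; axioms ⊆ {propext, Classical.choice, Quot.sound}.
-/

set_option autoImplicit false

open scoped BigOperators Matrix Matrix.Norms.L2Operator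
open Finset NormedSpace Set

namespace Summit.QuantumFields.BalabanUV.T4Continuum.NE7FreeLandauFirstVariation

open Literature.MathematicalPhysics.QuantumFieldTheory.Balaban1983to89
open B7Prop1Explicit UnitaryModel MatrixNorms
open T4AveragingDeficitWall (nReTrL nReTrL_apply hasDerivAt_exp_smul_zero hasDerivAt_exp_neg_smul_zero)
open T4AveragingDeficitWallBoundary (periodBox mem_periodBox)
open NE3HessBounds (nReTr_mul_comm nReTr_neg')
open AveragingDeficitNearIdentity (abs_nReTr_mul_le)
open T4TiltOscillation (nReTr_add nReTr_sub)
open NE7TraceLinkHessianLower (sum_shift_indicator)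
open NE7LatticeLandauMinimiser (nReTr_skew_eq_zero)

noncomputable section

variable {d : ℕ} {n : Type*} [Fintype n] [DecidableEq n]

/-! ## §1 The Euler–Lagrange expressions sum to zero over the box -/

omit [Fintype n] [DecidableEq n] in
/-- **THE FREE-BOUNDARY DIVERGENCES SUM TO ZERO**: for every bond field `X` on the box,
`Σ_{x ∈ box} Σ_κ [𝟙(x+e_κ ∈ box) X(x,κ) − 𝟙(x−e_κ ∈ box) X(x−e_κ,κ)] = 0`. [folklore] -/
theorem sum_EL_eq_zero {E : Type*} [AddCommGroup E] (M : ℕ) (X : Site d → Fin d → E) :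
    ∑ x ∈ periodBox (d := d) M, ∑ κ : Fin d, ((if x + e κ ∈ periodBox (d := d) M then X x κ else 0)
      - (if x - e κ ∈ periodBox (d := d) M then X (x - e κ) κ else 0)) = 0 := by
  rw [Finset.sum_comm]
  refine Finset.sum_eq_zero fun κ _ => ?_
  rw [Finset.sum_sub_distrib, sub_eq_zero]
  have h := sum_shift_indicator M κ (fun z => X (z - e κ) κ)
  simp only [add_sub_cancel_right] at h
  exact h

/-! ## §2 The first variation as a pairing with the Euler–Lagrange expression -/

omit [DecidableEq n] in
/-- **RESUMMATION OF THE FIRST VARIATION BY SITES**: `Σ_{x} Σ_κ 𝟙(x+e_κ ∈ box) Re tr(η_x V(x,κ) − V(x,κ) η_{x+e_κ})∕n = Σ_x Re tr(η_x D_V(x))∕n`,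
`D_V(x) = Σ_κ [𝟙(x+e_κ ∈ box) V(x,κ) − 𝟙(x−e_κ ∈ box) V(x−e_κ,κ)]`. [folklore] -/
theorem firstVar_resum (M : ℕ) (η : Site d → Matrix n n ℂ) (V : Site d → Fin d → Matrix n n ℂ) :
    ∑ x ∈ periodBox (d := d) M, ∑ κ : Fin d, (if x + e κ ∈ periodBox (d := d) M then nReTr (η x * V x κ - V x κ * η (x + e κ)) else 0)
      = ∑ x ∈ periodBox (d := d) M, nReTr (η x * ∑ κ : Fin d, ((if x + e κ ∈ periodBox (d := d) M then V x κ else 0)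
          - (if x - e κ ∈ periodBox (d := d) M then V (x - e κ) κ else 0))) := by
  have hsplit : ∀ (x : Site d) (κ : Fin d), (if x + e κ ∈ periodBox (d := d) M then nReTr (η x * V x κ - V x κ * η (x + e κ)) else 0)
      = (if x + e κ ∈ periodBox (d := d) M then nReTr (η x * V x κ) else 0)
        - (if x + e κ ∈ periodBox (d := d) M then nReTr (η (x + e κ) * V x κ) else 0) := by
    intro x κ
    split_ifs
    · rw [nReTr_sub, nReTr_mul_comm (V x κ)]
    · simp
  have hL : ∑ x ∈ periodBox (d := d) M, ∑ κ : Fin d, (if x + e κ ∈ periodBox (d := d) M then nReTr (η x * V x κ - V x κ * η (x + e κ)) else 0)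
      = ∑ x ∈ periodBox (d := d) M, ∑ κ : Fin d, (if x + e κ ∈ periodBox (d := d) M then nReTr (η x * V x κ) else 0)
        - ∑ x ∈ periodBox (d := d) M, ∑ κ : Fin d, (if x + e κ ∈ periodBox (d := d) M then nReTr (η (x + e κ) * V x κ) else 0) := by
    simp only [hsplit, Finset.sum_sub_distrib]
  have htip : ∀ κ : Fin d, ∑ x ∈ periodBox (d := d) M, (if x + e κ ∈ periodBox (d := d) M then nReTr (η (x + e κ) * V x κ) else 0)
      = ∑ z ∈ periodBox (d := d) M, (if z - e κ ∈ periodBox (d := d) M then nReTr (η z * V (z - e κ) κ) else 0) := by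
    intro κ
    have h := sum_shift_indicator M κ (fun z => nReTr (η z * V (z - e κ) κ))
    simp only [add_sub_cancel_right] at h
    exact h
  have h1 : ∑ x ∈ periodBox (d := d) M, ∑ κ : Fin d, (if x + e κ ∈ periodBox (d := d) M then nReTr (η (x + e κ) * V x κ) else 0)
      = ∑ x ∈ periodBox (d := d) M, ∑ κ : Fin d, (if x - e κ ∈ periodBox (d := d) M then nReTr (η x * V (x - e κ) κ) else 0) := by
    rw [Finset.sum_comm]
    exact (Finset.sum_congr rfl fun κ _ => htip κ).trans Finset.sum_comm
  rw [hL, h1, ← Finset.sum_sub_distrib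
    (fun x => ∑ κ : Fin d, (if x + e κ ∈ periodBox (d := d) M then nReTr (η x * V x κ) else 0))
    (fun x => ∑ κ : Fin d, (if x - e κ ∈ periodBox (d := d) M then nReTr (η x * V (x - e κ) κ) else 0))]
  apply Finset.sum_congr rfl
  intro x _
  have hlin : nReTr (η x * ∑ κ : Fin d, ((if x + e κ ∈ periodBox (d := d) M then V x κ else 0)
        - (if x - e κ ∈ periodBox (d := d) M then V (x - e κ) κ else 0)))
      = ∑ κ : Fin d, nReTr (η x * (((if x + e κ ∈ periodBox (d := d) M then V x κ else 0)
        - (if x - e κ ∈ periodBox (d := d) M then V (x - e κ) κ else 0)))) := by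
    rw [Finset.mul_sum]
    have h := map_sum (nReTrL (n := n)) (fun κ : Fin d => η x * (((if x + e κ ∈ periodBox (d := d) M then V x κ else 0)
        - (if x - e κ ∈ periodBox (d := d) M then V (x - e κ) κ else 0)))) Finset.univ
    simpa only [nReTrL_apply] using h
  rw [hlin, ← Finset.sum_sub_distrib
    (fun κ => (if x + e κ ∈ periodBox (d := d) M then nReTr (η x * V x κ) else 0))
    (fun κ => (if x - e κ ∈ periodBox (d := d) M then nReTr (η x * V (x - e κ) κ) else 0))]
  refine Finset.sum_congr rfl fun κ _ => ?_
  split_ifs <;> simp [mul_sub, nReTr] <;> ring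

omit [DecidableEq n] in
/-- For skew `K`: `Re tr(KD) = ½·Re tr(K(D − Dᴴ))` — a skew test matrix only sees the odd part. [folklore] -/
theorem nReTr_skew_mul_eq_half {K : Matrix n n ℂ} (hK : K ∈ skewAdjoint (Matrix n n ℂ)) (D : Matrix n n ℂ) :
    nReTr (K * D) = (1 / 2) * nReTr (K * (D - Dᴴ)) := by
  have hK' : Kᴴ = -K := by rw [← Matrix.star_eq_conjTranspose]; exact skewAdjoint.mem_iff.1 hK
  have h : nReTr (K * Dᴴ) = -nReTr (K * D) := by
    rw [← nReTr_conjTranspose (K * Dᴴ), Matrix.conjTranspose_mul, Matrix.conjTranspose_conjTranspose, hK', mul_neg, nReTr_neg',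
      nReTr_mul_comm]
  rw [mul_sub, nReTr_sub, h]; ring

/-- **THE FIRST VARIATION IS CONTROLLED BY THE EULER–LAGRANGE DEFECT**: for `η` skew on the box,
`|Σ_x Σ_κ 𝟙(x+e_κ ∈ box) Re tr(η_xV(x,κ) − V(x,κ)η_{x+e_κ})∕n| ≤ ½·Σ_x ‖η_x‖·‖E_V(x)‖`, `E_V = D_V − D_Vᴴ`. [folklore] -/
theorem abs_firstVar_le (M : ℕ) (η : Site d → Matrix n n ℂ) (hη : ∀ x ∈ periodBox (d := d) M, η x ∈ skewAdjoint (Matrix n n ℂ))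
    (V : Site d → Fin d → Matrix n n ℂ) :
    |∑ x ∈ periodBox (d := d) M, ∑ κ : Fin d, (if x + e κ ∈ periodBox (d := d) M then nReTr (η x * V x κ - V x κ * η (x + e κ)) else 0)|
      ≤ (1 / 2) * ∑ x ∈ periodBox (d := d) M, ‖η x‖ * ‖(∑ κ : Fin d, ((if x + e κ ∈ periodBox (d := d) M then V x κ else 0)
          - (if x - e κ ∈ periodBox (d := d) M then V (x - e κ) κ else 0)))
          - (∑ κ : Fin d, ((if x + e κ ∈ periodBox (d := d) M then V x κ else 0)
          - (if x - e κ ∈ periodBox (d := d) M then V (x - e κ) κ else 0)))ᴴ‖ := by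
  rw [firstVar_resum, Finset.mul_sum]
  refine (Finset.abs_sum_le_sum_abs _ _).trans (Finset.sum_le_sum fun x hx => ?_)
  rw [nReTr_skew_mul_eq_half (hη x hx), abs_mul, abs_of_pos (by norm_num : (0 : ℝ) < 1 / 2)]
  exact mul_le_mul_of_nonneg_left (abs_nReTr_mul_le _ _) (by norm_num)

/-! ## §3 Single-site variations and the Euler–Lagrange equation -/

/-- Each summand of the functional along a single-site variation at `y`: its derivative at `0`. [folklore] -/
theorem hasDerivAt_siteVariation_term (W : Site d → Fin d → Matrix n n ℂ) (y x : Site d) (κ : Fin d) (Z : Matrix n n ℂ) :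
    HasDerivAt (fun t : ℝ => 1 - nReTr ((if x = y then exp ((t : ℂ) • Z) else 1) * W x κ * (if x + e κ = y then exp (-((t : ℂ) • Z)) else 1)))
      (-nReTr ((if x = y then Z * W x κ else 0) - (if x + e κ = y then W x κ * Z else 0))) 0 := by
  have hF : ∀ (f : ℝ → Matrix n n ℂ) (f' : Matrix n n ℂ), HasDerivAt f f' 0 →
      HasDerivAt (fun t : ℝ => 1 - nReTr (f t)) (-nReTr f') 0 := by
    intro f f' hf
    have h := ((nReTrL (n := n)).hasFDerivAt.comp_hasDerivAt (0 : ℝ) hf).const_sub 1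
    simpa [Function.comp_def] using h
  by_cases hx : x = y <;> by_cases hx' : x + e κ = y
  · simp only [if_pos hx, if_pos hx']
    have h := ((hasDerivAt_exp_smul_zero Z).mul_const (W x κ)).mul (hasDerivAt_exp_neg_smul_zero Z)
    refine (hF _ _ h).congr_deriv ?_
    simp only [Complex.ofReal_zero, zero_smul, neg_zero, exp_zero, mul_one, one_mul]
    congr 1; noncomm_ring
  · simp only [if_pos hx, if_neg hx', mul_one, sub_zero]
    exact hF _ _ ((hasDerivAt_exp_smul_zero Z).mul_const (W x κ))
  · simp only [if_neg hx, if_pos hx', one_mul, zero_sub, nReTr_neg', neg_neg]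
    have h := hF _ _ ((hasDerivAt_exp_neg_smul_zero Z).const_mul (W x κ))
    simp only [mul_neg, nReTr_neg', neg_neg] at h
    exact h
  · simp only [if_neg hx, if_neg hx', one_mul, mul_one, sub_zero]
    have h := hF (fun _ => W x κ) 0 (hasDerivAt_const 0 _)
    simpa [nReTr] using h

/-- **THE DERIVATIVE OF THE FUNCTIONAL ALONG A SINGLE-SITE VARIATION**: for links `W` on the box and a site `y ∈ box`, the free-boundary trace
functional of the links `L_t(x)·W(x,κ)·R_t(x+e_κ)` (`L_t = e^{tZ}` at `y`, `1` elsewhere; `R_t = e^{−tZ}` at `y`, `1` elsewhere) has derivative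
`−Re tr(Z·D_W(y))∕n` at `t = 0`, `D_W(y) = Σ_κ[𝟙(y+e_κ ∈ box)W(y,κ) − 𝟙(y−e_κ ∈ box)W(y−e_κ,κ)]`. [folklore] -/
theorem hasDerivAt_siteVariation (M : ℕ) (W : Site d → Fin d → Matrix n n ℂ) {y : Site d} (hy : y ∈ periodBox (d := d) M)
    (Z : Matrix n n ℂ) :
    HasDerivAt (fun t : ℝ => ∑ x ∈ periodBox (d := d) M, ∑ κ : Fin d, (if x + e κ ∈ periodBox (d := d) M then
        (1 - nReTr ((if x = y then exp ((t : ℂ) • Z) else 1) * W x κ * (if x + e κ = y then exp (-((t : ℂ) • Z)) else 1))) else 0))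
      (-nReTr (Z * ∑ κ : Fin d, ((if y + e κ ∈ periodBox (d := d) M then W y κ else 0)
          - (if y - e κ ∈ periodBox (d := d) M then W (y - e κ) κ else 0)))) 0 := by
  have hsum : HasDerivAt (fun t : ℝ => ∑ x ∈ periodBox (d := d) M, ∑ κ : Fin d, (if x + e κ ∈ periodBox (d := d) M then
        (1 - nReTr ((if x = y then exp ((t : ℂ) • Z) else 1) * W x κ * (if x + e κ = y then exp (-((t : ℂ) • Z)) else 1))) else 0))
      (∑ x ∈ periodBox (d := d) M, ∑ κ : Fin d, (if x + e κ ∈ periodBox (d := d) M then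
        (-nReTr ((if x = y then Z * W x κ else 0) - (if x + e κ = y then W x κ * Z else 0))) else 0)) 0 := by
    refine HasDerivAt.fun_sum fun x _ => HasDerivAt.fun_sum fun κ _ => ?_
    by_cases h : x + e κ ∈ periodBox (d := d) M
    · simp only [h, if_true]; exact hasDerivAt_siteVariation_term W y x κ Z
    · simp only [h, if_false]; exact hasDerivAt_const 0 _
  refine hsum.congr_deriv ?_
  -- evaluate the sum of the derivatives
  have hlin : ∀ (s : Finset (Fin d)) (f : Fin d → Matrix n n ℂ), nReTr (∑ κ ∈ s, f κ) = ∑ κ ∈ s, nReTr (f κ) := fun s f => by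
    have h := map_sum (nReTrL (n := n)) f s
    simpa only [nReTrL_apply] using h
  have hlinS : ∀ (s : Finset (Site d)) (f : Site d → Matrix n n ℂ), nReTr (∑ x ∈ s, f x) = ∑ x ∈ s, nReTr (f x) := fun s f => by
    have h := map_sum (nReTrL (n := n)) f s
    simpa only [nReTrL_apply] using h
  have h1 : ∀ (x : Site d) (κ : Fin d), (if x + e κ ∈ periodBox (d := d) M then
        (-nReTr ((if x = y then Z * W x κ else 0) - (if x + e κ = y then W x κ * Z else 0))) else 0)
      = -nReTr (if x = y then (if x + e κ ∈ periodBox (d := d) M then Z * W x κ else 0) else 0)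
        + nReTr (if x + e κ = y then (if x + e κ ∈ periodBox (d := d) M then W x κ * Z else 0) else 0) := by
    intro x κ
    by_cases h : x + e κ ∈ periodBox (d := d) M
    · simp only [h, if_true, nReTr_sub]; ring
    · simp only [h, if_false]; split_ifs <;> simp [nReTr]
  simp only [h1, Finset.sum_add_distrib, Finset.sum_neg_distrib]
  rw [Finset.sum_comm (f := fun x κ => nReTr (if x = y then (if x + e κ ∈ periodBox (d := d) M then Z * W x κ else 0) else 0)),
    Finset.sum_comm (f := fun x κ => nReTr (if x + e κ = y then (if x + e κ ∈ periodBox (d := d) M then W x κ * Z else 0) else 0))]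
  have h2 : ∀ κ : Fin d, ∑ x ∈ periodBox (d := d) M, nReTr (if x = y then (if x + e κ ∈ periodBox (d := d) M then Z * W x κ else 0) else 0)
      = nReTr (if y + e κ ∈ periodBox (d := d) M then Z * W y κ else 0) := by
    intro κ
    rw [← hlinS]; congr 1
    rw [Finset.sum_ite_eq' (periodBox (d := d) M) y, if_pos hy]
  have h3 : ∀ κ : Fin d, ∑ x ∈ periodBox (d := d) M, nReTr (if x + e κ = y then (if x + e κ ∈ periodBox (d := d) M then W x κ * Z else 0) else 0)
      = nReTr (if y - e κ ∈ periodBox (d := d) M then W (y - e κ) κ * Z else 0) := by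
    intro κ
    rw [← hlinS]; congr 1
    have heq : ∀ x : Site d, (x + e κ = y) ↔ (x = y - e κ) := fun x => by
      constructor
      · intro h; rw [← h, add_sub_cancel_right]
      · intro h; rw [h, sub_add_cancel]
    simp only [heq]
    rw [Finset.sum_ite_eq' (periodBox (d := d) M) (y - e κ)]
    by_cases hmem : y - e κ ∈ periodBox (d := d) M
    · rw [if_pos hmem, if_pos hmem, sub_add_cancel, if_pos hy]
    · rw [if_neg hmem, if_neg hmem]
  simp only [h2, h3]
  rw [Finset.mul_sum, hlin]
  have h4 : ∀ κ : Fin d, nReTr (Z * ((if y + e κ ∈ periodBox (d := d) M then W y κ else 0) - (if y - e κ ∈ periodBox (d := d) M then W (y - e κ) κ else 0)))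
      = nReTr (if y + e κ ∈ periodBox (d := d) M then Z * W y κ else 0) - nReTr (if y - e κ ∈ periodBox (d := d) M then W (y - e κ) κ * Z else 0) := by
    intro κ
    rw [mul_sub, nReTr_sub]
    congr 1
    · split_ifs <;> simp
    · split_ifs <;> [rw [nReTr_mul_comm]; simp]
  simp only [h4, Finset.sum_sub_distrib]
  ring

/-- **CRITICALITY IN EVERY SKEW DIRECTION FORCES THE EULER–LAGRANGE EQUATION**: if `Re tr(Z·D)∕n = 0` for every skew `Z`, then
`D − Dᴴ = 0`. [folklore] -/
theorem EL_of_critical [Nonempty n] {D : Matrix n n ℂ} (h : ∀ Z : Matrix n n ℂ, Z ∈ skewAdjoint (Matrix n n ℂ) → nReTr (Z * D) = 0) :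
    D - Dᴴ = 0 :=
  nReTr_skew_eq_zero h

/-! ## §4 A second-order Taylor lower bound on the unit interval -/

omit [Fintype n] [DecidableEq n] in
/-- **SECOND-ORDER TAYLOR LOWER BOUND ON `[0,1]`**: if `g` has derivative `g′` and `g′` has derivative `g″` everywhere, and `c ≤ g″` on `[0,1]`,
then `g′(0) + c∕2 ≤ g(1) − g(0)`. [folklore] -/
theorem taylor_lower_unit_interval {g g' g'' : ℝ → ℝ} {c : ℝ} (hg : ∀ t, HasDerivAt g (g' t) t) (hg' : ∀ t, HasDerivAt g' (g'' t) t)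
    (hc : ∀ t ∈ Icc (0 : ℝ) 1, c ≤ g'' t) : g' 0 + c / 2 ≤ g 1 - g 0 := by
  -- `φ(t) = g′(t) − g′(0) − c t` is nondecreasing on `[0,1]`
  have hφ : ∀ t ∈ Icc (0 : ℝ) 1, 0 ≤ g' t - g' 0 - c * t := by
    intro t ht
    have hφ' : ∀ s : ℝ, HasDerivAt (fun s => g' s - g' 0 - c * s) (g'' s - c) s := by
      intro s
      have h := ((hg' s).sub_const (g' 0)).sub ((hasDerivAt_id s).const_mul c)
      refine h.congr_deriv ?_
      simp only [mul_one]
    have hmono := monotoneOn_of_deriv_nonneg (convex_Icc (0 : ℝ) 1) (f := fun s => g' s - g' 0 - c * s)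
      (fun s _ => (hφ' s).continuousAt.continuousWithinAt)
      (fun s _ => (hφ' s).differentiableAt.differentiableWithinAt)
      (fun s hs => by
        rw [interior_Icc] at hs
        rw [(hφ' s).deriv]
        have := hc s ⟨hs.1.le, hs.2.le⟩
        linarith)
    have h := hmono (left_mem_Icc.2 zero_le_one) ht ht.1
    simp only [mul_zero, sub_self] at h
    exact h
  -- `ψ(t) = g(t) − g′(0) t − (c/2) t²` is nondecreasing on `[0,1]`
  have hψ' : ∀ s : ℝ, HasDerivAt (fun s => g s - g' 0 * s - c / 2 * s ^ 2) (g' s - g' 0 - c * s) s := by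
    intro s
    have h := ((hg s).sub ((hasDerivAt_id s).const_mul (g' 0))).sub ((hasDerivAt_pow 2 s).const_mul (c / 2))
    refine h.congr_deriv ?_
    simp only [Nat.cast_ofNat, mul_one]; ring
  have hmono := monotoneOn_of_deriv_nonneg (convex_Icc (0 : ℝ) 1) (f := fun s => g s - g' 0 * s - c / 2 * s ^ 2)
    (fun s _ => (hψ' s).continuousAt.continuousWithinAt) (fun s _ => (hψ' s).differentiableAt.differentiableWithinAt)
    (fun s hs => by
      rw [interior_Icc] at hs
      rw [(hψ' s).deriv]
      exact hφ s ⟨hs.1.le, hs.2.le⟩)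
  have h := hmono (left_mem_Icc.2 zero_le_one) (right_mem_Icc.2 zero_le_one) zero_le_one
  simp only [mul_zero, sub_zero, mul_one, one_pow, zero_pow two_ne_zero] at h
  linarith

end

end Summit.QuantumFields.BalabanUV.T4Continuum.NE7FreeLandauFirstVariation
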